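import Summits.CriticalPhenomena.PercolationContinuityZ3.Theorems.PercNearOneGluingNoHeavyLowerTailSahiSliceMinimumUniformAxis
import Mathlib.Tactic.Linarith
import Mathlib.Tactic.NormNum
import Mathlib.Tactic.FinCases
import HarnessLib

/-!
# `NoHeavyLowerTail` (crux stmt-CriticalPhenomena-4575), Sahi programme P2 (gen 16): the slice axis CANNOT be chosen
# independently of the measure — `SahiSliceMinimum.UniformSliceAxis` fails on five coins

Support file (`--supports stmt-CriticalPhenomena-4575`; companion of `…SahiSliceMinimumUniformAxis`).  No `sorry`, no named facts,
standard axioms; a kernel-checked finite computation.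

THE STATEMENT REFUTED.  `UniformSliceAxis`: for every triple of increasing events and every nonempty determining set `S` there is
ONE `a ∈ S` with `min(Φ_a(1), Φ_a(0)) ≤ Φ_a(q_a)` for ALL product measures `q` (the slice axis of the SLICE MINIMUM PRINCIPLE chosen
from the triple alone).  True for all triples on `≤ 4` coins over large random panels of measures (exhaustive), and for every
triple with a forced coordinate (`uniformSliceAxis_of_forced`); FALSE from six coins on.  (The measure-dependent `SliceAxis` — the
slice minimum principle itself — is NOT affected: at each of the six witness measures below some OTHER axis is a slice axis.)

THE WITNESS (found by a hill-climbing adversary restricted to triples without forced coordinates; exact rational verification;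
this seat, memo FROM-prim-masterthm-p2-g16-SLICE-MINIMUM-PRINCIPLE.md §7).  `ι = Fin 5`, events generated (as up-sets) by
  `A = ↑{x₀, x₃x₄}`,  `B = ↑{x₀x₁, x₁x₃, x₁x₄, x₂x₄, x₃x₄}`,  `C = ↑{x₀x₂, x₁x₂, x₁x₃, x₂x₃, x₁x₄, x₂x₄, x₀x₃x₄}`,
`S` = all five coordinates, and for the axis `a` the product measure `q⁽ᵃ⁾ = n⁽ᵃ⁾/20`:
  `n⁽⁰⁾ = (10,0,17,2,3)`, `n⁽¹⁾ = (0,10,13,3,15)`, `n⁽²⁾ = (0,17,11,6,14)`, `n⁽³⁾ = (12,10,10,7,0)`, `n⁽⁴⁾ = (5,3,16,0,12)`.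
Along axis `a` at `q⁽ᵃ⁾` BOTH sectional values exceed `E_3`; the dips `min(Φ_a(1),Φ_a(0)) − Φ_a(q_a)` are
`1198209/8·10⁸, 22617/5.12·10⁷, 37559781/8·10¹⁰, 21/12500, 1591/10⁶`.  Frozen coordinates (`q_i ∈ {0,1}`) are legitimate product
measures; by continuity nearby interior measures work as well.  On `≤ 4` coins no such triple exists in the census (memo §7.1).
METHOD.  For `q = n/N` the product weight of the coded point `j < 32` is `w(j)/N⁵`, `w(j) = ∏_i (n_i or N − n_i)`; with
`W_X = Σ_{j ∈ X} w(j)`: `N¹⁵·E_3 = P − M`, `P = 2N¹⁰W_{ABC} + W_AW_BW_C`, `M = N⁵(W_AW_{BC} + W_BW_{AC} + W_CW_{AB})`; the sections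
`q[a ↦ 1], q[a ↦ 0]` are the same with `n_a` replaced by `N`, `0`; the ten inequalities `P′ + M > P + M′` are ONE `decide` over
`a : Fin 5`.  HONEST FRAMING: a structural fact about the slice minimum principle (its axis is measure-dependent); Kahn's `C_3`,
`SliceAxis` / `SliceMinimumPrinciple 3` remain OPEN. [this work]
-/

noncomputable section

open scoped Classical

namespace Summit.CriticalPhenomena.PercolationContinuityZ3.Theorems

namespace SahiUniformAxisFalse

open Finset Function Literature.Combinatorics.Sahi2008
open Literature.Probability.Percolation (DeterminedBy determinedBy_iff)
open Literature.Probability.Percolation.DecisionTree (ind ind_of_mem ind_of_not_mem)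
open SahiC3Cube (pt)
open SahiCoordinateTwoThirdsFalse (ind_eq_ite)
open SahiSliceMinimum (UniformSliceAxis)

/-! ### 1. Up-sets generated by bitmask generators, and the witness triple -/

/-- The up-set of `Fin 5`-configurations generated by a list of generators coded as bitmasks. [this work] -/
def genUp (G : List ℕ) : Set (Set (Fin 5)) := {ω | ∃ g ∈ G, ∀ i : Fin 5, g.testBit i = true → i ∈ ω}

/-- A generated up-set is an up-set. [this work] -/
theorem isUpperSet_genUp (G : List ℕ) : IsUpperSet (genUp G) := by
  intro ω ω' hle hω
  obtain ⟨g, hg, h⟩ := hω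
  exact ⟨g, hg, fun i hi => hle (h i hi)⟩

/-- Boolean membership of a coded point in a generated up-set. [this work] -/
def bGen (G : List ℕ) (j : ℕ) : Bool := G.any fun g => (List.finRange 5).all fun i : Fin 5 => !g.testBit i || j.testBit i

/-- Membership of a coded point in a generated up-set is `bGen`. [this work] -/
theorem mem_genUp_pt (G : List ℕ) (j : ℕ) : pt 5 j ∈ genUp G ↔ bGen G j = true := by
  simp only [genUp, bGen, Set.mem_setOf_eq, List.any_eq_true, List.all_eq_true, List.mem_finRange, true_implies,
    Bool.or_eq_true, Bool.not_eq_true']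
  constructor
  · rintro ⟨g, hg, h⟩
    refine ⟨g, hg, fun i => ?_⟩
    by_cases hb : g.testBit i = true
    · exact Or.inr (h i hb)
    · exact Or.inl (Bool.eq_false_iff.2 hb)
  · rintro ⟨g, hg, h⟩
    refine ⟨g, hg, fun i hi => ?_⟩
    rcases h i with h0 | h1
    · rw [hi] at h0; exact absurd h0 (by decide)
    · exact h1
/-- Generators of `A` (bitmasks, bit `i` = coordinate `x_i`). [this work] -/
def gensA : List ℕ := [1, 24]

/-- Generators of `B`. [this work] -/
def gensB : List ℕ := [3, 10, 18, 20, 24]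

/-- Generators of `C`. [this work] -/
def gensC : List ℕ := [5, 6, 10, 12, 18, 20, 25]

/-- The event `A`. [this work] -/
def uaA : Set (Set (Fin 5)) := genUp gensA

/-- The event `B`. [this work] -/
def uaB : Set (Set (Fin 5)) := genUp gensB

/-- The event `C`. [this work] -/
def uaC : Set (Set (Fin 5)) := genUp gensC

/-- The witness triple. [this work] -/
def uaU : Fin 3 → Set (Set (Fin 5)) := ![uaA, uaB, uaC]

/-- All three events are up-sets. [this work] -/
theorem isUpperSet_uaU : ∀ j, IsUpperSet (uaU j) := by
  intro j; fin_cases j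
  · exact isUpperSet_genUp gensA
  · exact isUpperSet_genUp gensB
  · exact isUpperSet_genUp gensC

/-- Every event is determined by the full coordinate set. [folklore] -/
theorem determinedBy_univ' (X : Set (Set (Fin 5))) : DeterminedBy X (↑(Finset.univ : Finset (Fin 5)) : Set (Fin 5)) := by
  rw [determinedBy_iff]
  intro ω ω' h
  simp only [Finset.coe_univ, Set.inter_univ] at h
  rw [h]

/-! ### 2. Rational product measures: integer weights and expectations as sums over the 64 codes -/

/-- The five numerator vectors `n⁽ᵃ⁾` (row `a` = the measure refuting axis `a`). [this work] -/
def numer : Fin 5 → Fin 5 → ℕ :=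
  ![![10, 0, 17, 2, 3], ![0, 10, 13, 3, 15], ![0, 17, 11, 6, 14], ![12, 10, 10, 7, 0], ![5, 3, 16, 0, 12]]

/-- The five denominators `N⁽ᵃ⁾`. [this work] -/
def denom : Fin 5 → ℕ := ![20, 20, 20, 20, 20]

/-- Numerators are at most the denominator (kernel check). [this work] -/
theorem numer_le_denom : ∀ a i : Fin 5, numer a i ≤ denom a := by decide

/-- Denominators are positive (kernel check). [this work] -/
theorem denom_pos : ∀ a : Fin 5, 0 < denom a := by decide

/-- The measure `q⁽ᵃ⁾ = n⁽ᵃ⁾/N⁽ᵃ⁾` refuting axis `a`. [this work] -/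
def qOf (a : Fin 5) : Fin 5 → unitInterval := fun i =>
  ⟨(numer a i : ℝ) / denom a, by
    constructor
    · positivity
    · rw [div_le_one (by exact_mod_cast denom_pos a)]
      exact_mod_cast numer_le_denom a i⟩

/-- `(q⁽ᵃ⁾_i : ℝ) = n⁽ᵃ⁾_i / N⁽ᵃ⁾`. [this work] -/
theorem coe_qOf (a i : Fin 5) : ((qOf a i : unitInterval) : ℝ) = (numer a i : ℝ) / denom a := rfl

/-- The integer weight of the coded point `j` for numerators `m` over `N`: `∏_i (m_i if bit i of j else N − m_i)`. [this work] -/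
def numW (m : Fin 5 → ℕ) (N : ℕ) (j : ℕ) : ℕ := ∏ i : Fin 5, if j.testBit i = true then m i else N - m i

/-- `i ∈ pt 5 j ↔` bit `i` of `j` is set. [this work] -/
theorem mem_pt_iff (i : Fin 5) (j : ℕ) : i ∈ pt 5 j ↔ j.testBit i = true := Iff.rfl

/-- **Product weight of a rational product measure**: if `(q_i : ℝ) = m_i/N` with `m_i ≤ N`, `N > 0`, then the weight of the
coded point `j` is `numW m N j / N⁶`. [this work] -/
theorem weight_of_rat (q : Fin 5 → unitInterval) (m : Fin 5 → ℕ) (N : ℕ) (hN : 0 < N)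
    (hq : ∀ i, ((q i : unitInterval) : ℝ) = (m i : ℝ) / N) (hm : ∀ i, m i ≤ N) (j : ℕ) :
    bernoulliWeight q (pt 5 j) = (numW m N j : ℝ) / (N : ℝ) ^ 5 := by
  show (∏ i : Fin 5, if i ∈ pt 5 j then ((q i : unitInterval) : ℝ) else 1 - ((q i : unitInterval) : ℝ)) = _
  have hN' : (N : ℝ) ≠ 0 := by exact_mod_cast hN.ne'
  have h : ∀ i : Fin 5, (if i ∈ pt 5 j then ((q i : unitInterval) : ℝ) else 1 - ((q i : unitInterval) : ℝ))
      = ((if j.testBit i = true then m i else N - m i : ℕ) : ℝ) / N := by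
    intro i
    rw [hq i]
    by_cases hb : j.testBit i = true
    · rw [if_pos ((mem_pt_iff i j).2 hb), if_pos hb]
    · rw [if_neg (fun h => hb ((mem_pt_iff i j).1 h)), if_neg hb, Nat.cast_sub (hm i)]
      field_simp
  rw [Finset.prod_congr rfl fun i _ => h i, Finset.prod_div_distrib, Finset.prod_const, Finset.card_univ,
    Fintype.card_fin, numW]
  push_cast
  rfl

/-- Expectation under a rational product measure as a weighted sum over the codes. [this work] -/
theorem ex_of_rat (q : Fin 5 → unitInterval) (m : Fin 5 → ℕ) (N : ℕ) (hN : 0 < N)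
    (hq : ∀ i, ((q i : unitInterval) : ℝ) = (m i : ℝ) / N) (hm : ∀ i, m i ≤ N) (F : Set (Fin 5) → ℝ) :
    ex (bernoulliWeight q) F = (1 / (N : ℝ) ^ 5) * ∑ j ∈ Finset.range 32, (numW m N j : ℝ) * F (pt 5 j) := by
  rw [ex_def, SahiTransportJR.sum_eq_sum_range (m := 5) (fun x => bernoulliWeight q x * F x), Finset.mul_sum]
  refine Finset.sum_congr (by norm_num) fun j _ => ?_
  rw [weight_of_rat q m N hN hq hm]; ring

/-! ### 3. Boolean membership and the weighted counts -/

/-- Bits of `A`, `B`, `C`. [this work] -/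
def bA (j : ℕ) : Bool := bGen gensA j

/-- Bits of `B`. [this work] -/
def bB (j : ℕ) : Bool := bGen gensB j

/-- Bits of `C`. [this work] -/
def bC (j : ℕ) : Bool := bGen gensC j

/-- Memberships of coded points. [this work] -/
theorem mem_ua (j : ℕ) : (pt 5 j ∈ uaA ↔ bA j = true) ∧ (pt 5 j ∈ uaB ↔ bB j = true) ∧ (pt 5 j ∈ uaC ↔ bC j = true) :=
  ⟨mem_genUp_pt gensA j, mem_genUp_pt gensB j, mem_genUp_pt gensC j⟩

/-- Weighted count `W_c(m, N) = Σ_{j : c} numW m N j`. [this work] -/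
def Wc (m : Fin 5 → ℕ) (N : ℕ) (c : ℕ → Bool) : ℕ := ∑ j ∈ Finset.range 32, if c j = true then numW m N j else 0

/-- `numW·𝟙_c` summed in `ℝ` is the cast of `Wc`. [this work] -/
theorem sum_cast (m : Fin 5 → ℕ) (N : ℕ) (c : ℕ → Bool) :
    (∑ j ∈ Finset.range 32, (numW m N j : ℝ) * (if c j = true then 1 else 0)) = (Wc m N c : ℝ) := by
  rw [Wc]; push_cast
  refine Finset.sum_congr rfl fun j _ => ?_
  split_ifs <;> simp

/-- The positive part `P = 2N¹⁰W_{ABC} + W_AW_BW_C` of `N¹⁵E_3`. [this work] -/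
def Ppart (m : Fin 5 → ℕ) (N : ℕ) : ℕ :=
  2 * N ^ 10 * Wc m N (fun j => bA j && bB j && bC j) + Wc m N bA * Wc m N bB * Wc m N bC

/-- The negative part `M = N⁵(W_AW_{BC} + W_BW_{AC} + W_CW_{AB})` of `N¹⁵E_3`. [this work] -/
def Mpart (m : Fin 5 → ℕ) (N : ℕ) : ℕ :=
  N ^ 5 * (Wc m N bA * Wc m N (fun j => bB j && bC j) + Wc m N bB * Wc m N (fun j => bA j && bC j) +
    Wc m N bC * Wc m N (fun j => bA j && bB j))

/-- **`E_3` under a rational product measure**: `E_3(μ_q; A,B,C) = (P − M)/N¹⁵`. [this work] -/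
theorem sahiE_three_of_rat (q : Fin 5 → unitInterval) (m : Fin 5 → ℕ) (N : ℕ) (hN : 0 < N)
    (hq : ∀ i, ((q i : unitInterval) : ℝ) = (m i : ℝ) / N) (hm : ∀ i, m i ≤ N) :
    sahiE (bernoulliWeight q) 3 ![ind uaA, ind uaB, ind uaC] = ((Ppart m N : ℝ) - (Mpart m N : ℝ)) / (N : ℝ) ^ 15 := by
  have hN' : (N : ℝ) ≠ 0 := by exact_mod_cast hN.ne'
  rw [sahiE_three]
  simp only [ex_of_rat q m N hN hq hm, Pi.mul_apply, ind_eq_ite _ _ _ (mem_ua _).1, ind_eq_ite _ _ _ (mem_ua _).2.1,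
    ind_eq_ite _ _ _ (mem_ua _).2.2, SahiCoordinateTwoThirdsFalse.ite_mul_ite, sum_cast]
  rw [Ppart, Mpart]
  generalize Wc m N (fun j => bA j && bB j && bC j) = S7
  generalize Wc m N (fun j => bA j && bB j) = S4
  generalize Wc m N (fun j => bA j && bC j) = S5
  generalize Wc m N (fun j => bB j && bC j) = S6
  generalize Wc m N bA = S1
  generalize Wc m N bB = S2
  generalize Wc m N bC = S3
  push_cast
  field_simp

/-! ### 4. The sections are rational measures with the same denominator, and the kernel inequalities -/

/-- `q⁽ᵃ⁾[a ↦ 1]` has numerators `n⁽ᵃ⁾[a ↦ N]`. [this work] -/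
theorem coe_update_one (a i : Fin 5) :
    ((update (qOf a) a 1 i : unitInterval) : ℝ) = ((update (numer a) a (denom a) i : ℕ) : ℝ) / denom a := by
  by_cases h : i = a
  · subst h
    rw [update_self, update_self, Set.Icc.coe_one, div_self]
    exact_mod_cast (denom_pos i).ne'
  · rw [update_of_ne h, update_of_ne h, coe_qOf]

/-- `q⁽ᵃ⁾[a ↦ 0]` has numerators `n⁽ᵃ⁾[a ↦ 0]`. [this work] -/
theorem coe_update_zero (a i : Fin 5) :
    ((update (qOf a) a 0 i : unitInterval) : ℝ) = ((update (numer a) a 0 i : ℕ) : ℝ) / denom a := by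
  by_cases h : i = a
  · subst h
    rw [update_self, update_self, Set.Icc.coe_zero]; simp
  · rw [update_of_ne h, update_of_ne h, coe_qOf]

/-- Updated numerators stay `≤ N`. [this work] -/
theorem update_le_denom (a : Fin 5) (v : ℕ) (hv : v ≤ denom a) : ∀ i, update (numer a) a v i ≤ denom a := by
  intro i
  by_cases h : i = a
  · subst h; rw [update_self]; exact hv
  · rw [update_of_ne h]; exact numer_le_denom a i

/-- **THE TEN KERNEL INEQUALITIES** (one `decide`, uniformly in the axis): along axis `a` at `q⁽ᵃ⁾` both sections have
larger `N¹⁵E_3`, i.e. `P(n[a↦N]) + M(n) > P(n) + M(n[a↦N])` and `P(n[a↦0]) + M(n) > P(n) + M(n[a↦0])`. [this work] -/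
theorem kernel_ineqs : ∀ a : Fin 5,
    Ppart (numer a) (denom a) + Mpart (update (numer a) a (denom a)) (denom a) <
        Ppart (update (numer a) a (denom a)) (denom a) + Mpart (numer a) (denom a) ∧
      Ppart (numer a) (denom a) + Mpart (update (numer a) a 0) (denom a) <
        Ppart (update (numer a) a 0) (denom a) + Mpart (numer a) (denom a) := by
  decide

/-! ### 5. The refutation -/

/-- Bridge to the tree's fibre cubic (classical `DecidableEq` instance inside `update`). [this work] -/
theorem sahiE_three_update_eq' (q : Fin 5 → unitInterval) (a : Fin 5) (s : unitInterval) :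
    sahiE (bernoulliWeight (update q a s)) 3 ![ind uaA, ind uaB, ind uaC] =
      cubicE3 q a (ind uaA) (ind uaB) (ind uaC) (s : ℝ) := by
  convert sahiE_three_update_eq q a s (ind uaA) (ind uaB) (ind uaC)

/-- **Along every axis `a`, at `q⁽ᵃ⁾`, BOTH sectional values exceed `E_3`.** [this work] -/
theorem both_sections_gt (a : Fin 5) :
    cubicE3 (qOf a) a (ind uaA) (ind uaB) (ind uaC) (qOf a a) < cubicE3 (qOf a) a (ind uaA) (ind uaB) (ind uaC) 1 ∧
      cubicE3 (qOf a) a (ind uaA) (ind uaB) (ind uaC) (qOf a a) < cubicE3 (qOf a) a (ind uaA) (ind uaB) (ind uaC) 0 := by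
  have hN := denom_pos a
  have hNr : (0 : ℝ) < (denom a : ℝ) ^ 15 := by positivity
  have hq : cubicE3 (qOf a) a (ind uaA) (ind uaB) (ind uaC) (qOf a a) =
      ((Ppart (numer a) (denom a) : ℝ) - (Mpart (numer a) (denom a) : ℝ)) / (denom a : ℝ) ^ 15 := by
    rw [← sahiE_three_update_eq' (qOf a) a (qOf a a), update_eq_self,
      sahiE_three_of_rat (qOf a) (numer a) (denom a) hN (coe_qOf a) (numer_le_denom a)]
  have h1 : cubicE3 (qOf a) a (ind uaA) (ind uaB) (ind uaC) 1 =
      ((Ppart (update (numer a) a (denom a)) (denom a) : ℝ) - (Mpart (update (numer a) a (denom a)) (denom a) : ℝ)) /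
        (denom a : ℝ) ^ 15 := by
    rw [← Set.Icc.coe_one, ← sahiE_three_update_eq' (qOf a) a 1,
      sahiE_three_of_rat (update (qOf a) a 1) (update (numer a) a (denom a)) (denom a) hN (coe_update_one a)
        (update_le_denom a (denom a) le_rfl)]
  have h0 : cubicE3 (qOf a) a (ind uaA) (ind uaB) (ind uaC) 0 =
      ((Ppart (update (numer a) a 0) (denom a) : ℝ) - (Mpart (update (numer a) a 0) (denom a) : ℝ)) /
        (denom a : ℝ) ^ 15 := by
    rw [← Set.Icc.coe_zero, ← sahiE_three_update_eq' (qOf a) a 0,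
      sahiE_three_of_rat (update (qOf a) a 0) (update (numer a) a 0) (denom a) hN (coe_update_zero a)
        (update_le_denom a 0 (Nat.zero_le _))]
  obtain ⟨k1, k0⟩ := kernel_ineqs a
  have k1' : (Ppart (numer a) (denom a) : ℝ) + (Mpart (update (numer a) a (denom a)) (denom a) : ℝ) <
      (Ppart (update (numer a) a (denom a)) (denom a) : ℝ) + (Mpart (numer a) (denom a) : ℝ) := by exact_mod_cast k1
  have k0' : (Ppart (numer a) (denom a) : ℝ) + (Mpart (update (numer a) a 0) (denom a) : ℝ) <
      (Ppart (update (numer a) a 0) (denom a) : ℝ) + (Mpart (numer a) (denom a) : ℝ) := by exact_mod_cast k0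
  rw [hq, h1, h0]
  constructor
  · rw [div_lt_div_iff_of_pos_right hNr]; linarith
  · rw [div_lt_div_iff_of_pos_right hNr]; linarith

/-- **`UniformSliceAxis` IS FALSE**: for the triple `(A, B, C)` on `Fin 5` and `S` = all coordinates, every axis `a` is beaten by
the measure `q⁽ᵃ⁾` — the slice axis of the slice minimum principle must depend on the measure. [this work] -/
theorem not_uniformSliceAxis : ¬ UniformSliceAxis := by
  intro h
  obtain ⟨a, -, ha⟩ := h (Fin 5) uaU isUpperSet_uaU Finset.univ Finset.univ_nonempty (fun i => determinedBy_univ' _)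
  have e0 : uaU 0 = uaA := rfl
  have e1 : uaU 1 = uaB := rfl
  have e2 : uaU 2 = uaC := rfl
  have hle := ha (qOf a)
  rw [e0, e1, e2] at hle
  obtain ⟨g1, g0⟩ := both_sections_gt a
  exact absurd hle (not_le.2 (lt_min g1 g0))

end SahiUniformAxisFalse

end Summit.CriticalPhenomena.PercolationContinuityZ3.Theorems
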